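import Summits.QuantumFields.BalabanUV.Beta.D1BFx.GluonLocalProjRow
import Summits.QuantumFields.BalabanUV.Beta.D1BFx.LocalVertexFormLeft

/-!
# `BalabanUV.Beta.D1BFx.GluonProjLocalRow` — road «BF-x» for binder row D1, slot (K), END row `hGrp gN`, «T₂-P»: THE `proj ⊗ SbT` PIECE OF THE GLUON
# NEEDLE ROW T₂ IS n-UNIFORM — `|cellSum n a (projPiece n a) SbT μ ν| ≤ C` for every `n ≥ 1`, ONE `C ≥ 0` — hypothesis `hp` of
# `GluonNeedleGlueT12.h₂_of_pieces` VERBATIM, modulo [B5, Prop. 1.2] ∧ [B5, (1.126)–(1.127)] BY NAME (the mirror of «GN-P» `GluonLocalProjRow`)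

HONEST DEPENDENCY (cell records, verbatim): «continuum YM on T⁴ ⇐ BetaPertH ∧ nine spine estimates (0/9 proved); BetaPertH ⇐ (D1) ∧ (D4) ∧
CAP+tail; G-an2-4 gates asym, D1 and NE2/3/4.»  HONEST FRAMING (cell contract, verbatim): «discharging `BetaPertH` makes Bałaban's UV stability
UNCONDITIONAL — a real constructive-QFT result; it is NOT the continuum limit and NOT the Clay problem.»  THIS MODULE DISCHARGES NOTHING of the
wall: [folklore] counting, modulo the two NAMED printed statements `B5.Prop12Printed (fam nOf hn1 MOf a ha)` ([B5, Prop. 1.2]) and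
`B5.Kernel126_127Printed (kfam nOf MOf)` ([B5, (1.126)–(1.127)]) which enter ONLY through the letters (`GluonLegProfile.exists_abs_Ga_le_profile`,
`GluonLegProfileD1.exists_abs_Ga_diff(_left)_le_profile`, `NeedleProjLetters.exists_applyK_colGrad_le`∕`_applyKT_rowGrad_le`,
`NeedleProjLettersD1.exists_applyK_colGrad_diff_le`∕`_applyKT_rowGrad_diff_le`, `GluonLegTails.spr_Ga_of_prop12`) — hypotheses, never proved here —
composed with the owner's TRANSPOSED frame `LocalVertexForm.exists_SbT_outer_bound_left` (absolute `K`, `R`), `RankOneBubble(Jets)` (`dJetSw_eq_outer_sub`,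
`applyK(T)_bondInd`, `bubble_outer_sub_left`, `locV_*`), `SectorRecut.exists_biLoc_SbT`, `RJetProjector.decays_Pgt`, `ProjectorSupNorm.abs_Pgt_diff_le_sup`,
`GluonLocalProjWord.profile_window`, `GluonLocalProjRow.abs_fullSum_le_of_envelope`, `NeedleProjProjRow.sum_resSite_avg_le`.  No `def`, no `def … : Prop`,
nothing cited beyond those two named statements, 0 sorry.  Root-level binders hW ∕ hR-sockets ∕ hSX-socket ∕ D1Tel ∕ D1Rep — 0 discharged; (K) NOT
closed; NOT D1, NOT `BetaPertH`, NOT continuum, NOT Clay.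

ABSOLUTE RULE (cell charter, verbatim): «No internally-minted statement may enter as a cited fact. Every hypothesis is either kernel-proved in
this package or a verbatim quotation of a PUBLISHED theorem with page reference. The manuscript(s) under audit are NOT citable for their own
disputed steps — they are the thing under adjudication; programme-internal (2001/route/tribunal) claims are never citable.»

WHY (owner records `HOME/b2b-balaban-beta-d1-p2/GLUON-NEEDLE-ROWS.md` v0.3, row «T₂-P»; `OWNER-MEMO-g10.md` §4 item 2).
THE COUNT.  The word at `(b, w)` is `−½·bubble Ga (dJetSw μ u P) (SbT ν b)`, `u = b + w`: the projector jet now sits in the FIRST slot at the bond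
`(μ, u)` and the transverse Wilson sector in the second at `(ν, b)`.  `dJetSw μ u P = c′ ⊗ δ − δ ⊗ r′` (`c′ = ∇_col P(·, u+e_μ)`, `r′ = ∇_row P(u+e_μ, ·)`,
`δ = δ_{(u,μ)}`).  By the transposed frame each rank-one term is `≤ K·(Φ₁Γ₀ + Φ₀Γ₁ + Φ₁Γ₁)` with the window bounds (radius `R`, centred at the
VERTEX `b`) of its row end `ψ·Ga` and column end `Ga·φ`: term 1 has row end `Ga(u, ·)` — read at `q` with `q − u = −w + (q − b)`: the entry and
second-variable d1 profiles of the leg centred at `u`, shifted by `profile_window` at `−w` (`‖−w‖ = ‖w‖`, `nrm(−w) = nrm w`) — and column end `Ga c′`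
(`kC∕n³`, `kC′∕n⁴`); term 2 has row end `r′Ga` (`kC∕n³`, `kC′∕n⁴`) and column end `Ga(·, u)` (entry profile read at `u − q = w + (−(q − b))`, first-variable
d1 profile at `q − u`).  Hence the SAME pointwise two-envelope bound as T₁-P, `K·[A₁c₃E₃(w)·(kC+kC′) + A₀c₂E₂(w)·kC′]`, and the same (1.22) count
`n⁻³·n³ + n⁻⁴·n⁴ = n⁰` (`abs_fullSum_le_of_envelope`), convex base average (`sum_resSite_avg_le`).
* §1 [folklore] **`abs_projLoc_word_le`** (pointwise, abstract letters and an abstract transposed frame `K, R`).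
* §2 [folklore] **`exists_projLoc_row_le`** (`∃ C ≥ 0, ∀ n [NeZero n], |cellSum n a (projPiece n a) SbT μ ν| ≤ C`, modulo `h12`∕`h126`).
NOT HERE (honest): the K- and Q̇-pieces of T₂ (`hd`, `hnd` of `h₂_of_pieces`).
Unit `b2b-balaban-beta-d1-p2` (gen 11), road «BF-x» OWNER; `LEAVES-BFx.md` row (N) «T₂-P».
-/

namespace Summit.QuantumFields.BalabanUV.Beta.D1BFx.GluonProjLocalRow

open Finset Real
open scoped BigOperators
open Literature.MathematicalPhysics.QuantumFieldTheory.Balaban1983to89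
open Literature.MathematicalPhysics.QuantumFieldTheory.Balaban1983to89.Beta
open B12Sec2to5 (l1 l1_nonneg)
open B6QGQLower276 (X e blk B mem_B)
open ExpKernelCalculus (Site MKer Decays bubble summable_exp_shift summable_exp_shift' l1_sub_symm)
open DyadicShell (Pt toReal toReal_apply)
open BubbleTransfer (unitVec)
open WindowIdentification (fullSum)
open DressedMomentNormalisation (resSite)
open VectorTailsLoc (fam kfam)
open PoissonInterior (nrm nrm_pos one_le_nrm nrm_neg supNorm supNorm_neg supNorm_add_le)
open Summit.QuantumFields.BalabanUV.Beta.TameKernelCalculus (Spr Loc)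
open Summit.QuantumFields.BalabanUV.Beta.D1BFx.PackedKernelSplit (biBubble bubble_eq_biBubble)
open Summit.QuantumFields.BalabanUV.Beta.D1BFx.FineHessianSectors (biBubbleTable biBubbleTable_apply)
open Summit.QuantumFields.BalabanUV.Beta.D1BFx.RProjector (Pgt Pgt_symm deltaPP deltaPP_pos)
open Summit.QuantumFields.BalabanUV.Beta.D1BFx.RJetProjector (decays_Pgt)
open Summit.QuantumFields.BalabanUV.Beta.D1BFx.ProjectorSupNorm (cPPs cPPs_nonneg abs_Pgt_diff_le_sup)
open Summit.QuantumFields.BalabanUV.Beta.D1BFx.GluonLeg (Ga Ga_apply Ga_symm)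
open Summit.QuantumFields.BalabanUV.Beta.D1BFx.GluonLegTails (spr_Ga_of_prop12)
open Summit.QuantumFields.BalabanUV.Beta.D1BFx.GluonLegProfile (exists_abs_Ga_le_profile)
open Summit.QuantumFields.BalabanUV.Beta.D1BFx.GluonLegProfileD1 (exists_abs_Ga_diff_le_profile exists_abs_Ga_diff_left_le_profile)
open Summit.QuantumFields.BalabanUV.Beta.D1BFx.FrozenLegTails (nOf MOf hn1)
open Summit.QuantumFields.BalabanUV.Beta.D1BFx.SectorRecut (SbT exists_biLoc_SbT)
open Summit.QuantumFields.BalabanUV.Beta.D1BFx.GluonNeedleSplit (projPiece projPiece_apply)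
open Summit.QuantumFields.BalabanUV.Beta.D1BFx.GluonNeedleGlue (cellSum cellSum_def)
open Summit.QuantumFields.BalabanUV.Beta.D1BFx.RankOneBubble (outer applyK applyKT pairing applyK_apply applyKT_apply bubble_outer_sub_left LocV)
open Summit.QuantumFields.BalabanUV.Beta.D1BFx.RankOneBubbleJets (bondInd bondInd_apply colGrad rowGrad dJetSw_eq_outer_sub applyK_bondInd applyKT_bondInd
  locV_bondInd locV_colGrad locV_rowGrad)
open Summit.QuantumFields.BalabanUV.Beta.D1BFx.NeedleProjLetters (exists_applyK_colGrad_le exists_applyKT_rowGrad_le)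
open Summit.QuantumFields.BalabanUV.Beta.D1BFx.NeedleProjLettersD1 (exists_applyK_colGrad_diff_le exists_applyKT_rowGrad_diff_le)
open Summit.QuantumFields.BalabanUV.Beta.D1BFx.NeedleProjProjRow (sum_resSite_avg_le)
open Summit.QuantumFields.BalabanUV.Beta.D1BFx.LatticeHLSProfiles (supNorm_dyadic)
open Summit.QuantumFields.BalabanUV.Beta.D1BFx.LocalVertexForm (exists_SbT_outer_bound_left)
open Summit.QuantumFields.BalabanUV.Beta.D1BFx.GluonLocalProjWord (profile_window)
open Summit.QuantumFields.BalabanUV.Beta.D1BFx.GluonLocalProjRow (abs_fullSum_le_of_envelope)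

noncomputable section

/-! ## §1 The word at one `(b, w)`: transposed frame × letters -/

section Word

variable (n : ℕ) [NeZero n] (a : ℝ)

/-- [folklore] **THE `proj ⊗ SbT` WORD AT ONE `(b, w)`** from an abstract transposed frame (`K`, `R` with the conclusion of
`LocalVertexForm.exists_SbT_outer_bound_left`) and abstract letters: the entry profile `A₀e^{−(δ∕n)‖·‖}∕nrm²` of `Ga`, its two d1 profiles `A₁e∕nrm³`,
the sup letters `KC` (point values of `Ga` on projector column ∕ row gradients) and `KC₁` (their unit differences):
`|biBubbleTable Ga Ga proj SbT μ ν (b+w) b| ≤ K·[A₁c₃E₃(w)·(KC + KC₁) + A₀c₂E₂(w)·KC₁]`, `E_p(w) = e^{−(δ∕n)‖w‖}∕nrm(w)^p`, `c_p = e^{δR}(R+1)^p` —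
the same right-hand side as `GluonLocalProjWord.abs_locProj_word_le` (the windows are now centred at the vertex `b` and read the profiles at `∓w + r`). -/
theorem abs_projLoc_word_le (ha : 0 < a) (hA : Spr (Ga n a)) {K : ℝ} {R : ℕ}
    (hframe : ∀ (κ : Fin 4) (u : Pt) (A B : MKer 4 (Fin 4)) (φ ψ : Pt → Fin 4 → ℝ),
      (∀ (r : Pt) (g : Fin 4), Summable fun y : Pt => ∑ a', ψ y a' * B y r a' g) →
      ∀ (Φ₀ Φ₁ Γ₀ Γ₁ : ℝ), 0 ≤ Φ₀ → 0 ≤ Φ₁ → 0 ≤ Γ₀ → 0 ≤ Γ₁ →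
      (∀ (q : Pt) (g : Fin 4), DyadicShell.supNorm (q - u) ≤ R → |applyKT ψ B q g| ≤ Φ₀) →
      (∀ (q : Pt) (g : Fin 4) (i : Fin 4), DyadicShell.supNorm (q - u) ≤ R → |applyKT ψ B (q + unitVec i) g - applyKT ψ B q g| ≤ Φ₁) →
      (∀ (q : Pt) (f : Fin 4), DyadicShell.supNorm (q - u) ≤ R → |applyK A φ q f| ≤ Γ₀) →
      (∀ (q : Pt) (f : Fin 4) (i : Fin 4), DyadicShell.supNorm (q - u) ≤ R → |applyK A φ (q + unitVec i) f - applyK A φ q f| ≤ Γ₁) →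
      |biBubble A (outer φ ψ) B (SbT κ u)| ≤ K * (Φ₁ * Γ₀ + Φ₀ * Γ₁ + Φ₁ * Γ₁))
    {A₀ A₁ δ KC KC₁ : ℝ} (hA₀ : 0 ≤ A₀) (hA₁ : 0 ≤ A₁) (hδ : 0 < δ) (hKC : 0 ≤ KC) (hKC₁ : 0 ≤ KC₁)
    (hprof : ∀ (x y : Pt) (κ l : Fin 4), |Ga n a x y κ l| ≤ A₀ * Real.exp (-(δ / n) * supNorm (d := 4) (y - x)) / nrm (d := 4) (y - x) ^ 2)
    (hdR : ∀ (x y : Pt) (κ l ρ : Fin 4), |Ga n a x (y + unitVec ρ) κ l - Ga n a x y κ l|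
      ≤ A₁ * Real.exp (-(δ / n) * supNorm (d := 4) (y - x)) / nrm (d := 4) (y - x) ^ 3)
    (hdL : ∀ (x y : Pt) (κ l ρ : Fin 4), |Ga n a (x + unitVec ρ) y κ l - Ga n a x y κ l|
      ≤ A₁ * Real.exp (-(δ / n) * supNorm (d := 4) (x - y)) / nrm (d := 4) (x - y) ^ 3)
    (hC0 : ∀ (q x : Pt) (α : Fin 4), |applyK (Ga n a) (colGrad (Pgt n a) q) x α| ≤ KC)
    (hC1 : ∀ (q x : Pt) (α i : Fin 4), |applyK (Ga n a) (colGrad (Pgt n a) q) (x + unitVec i) α - applyK (Ga n a) (colGrad (Pgt n a) q) x α| ≤ KC₁)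
    (hT0 : ∀ (p z : Pt) (β : Fin 4), |applyKT (rowGrad (Pgt n a) p) (Ga n a) z β| ≤ KC)
    (hT1 : ∀ (p z : Pt) (β i : Fin 4), |applyKT (rowGrad (Pgt n a) p) (Ga n a) (z + unitVec i) β - applyKT (rowGrad (Pgt n a) p) (Ga n a) z β| ≤ KC₁)
    (μ ν : Fin 4) (b w : Pt) :
    |biBubbleTable (Ga n a) (Ga n a) (projPiece n a) SbT μ ν (b + w) b|
      ≤ K * (A₁ * (Real.exp (δ * R) * ((R : ℝ) + 1) ^ 3) * (Real.exp (-(δ / n) * supNorm (d := 4) w) / nrm (d := 4) w ^ 3) * (KC + KC₁)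
        + A₀ * (Real.exp (δ * R) * ((R : ℝ) + 1) ^ 2) * (Real.exp (-(δ / n) * supNorm (d := 4) w) / nrm (d := 4) w ^ 2) * KC₁) := by
  have hn1 : 1 ≤ n := NeZero.one_le
  set u : Pt := b + w with hu
  -- the envelopes (at `w`; the profiles are read at `−w + r` or `w + (−r)`)
  set E₂ : ℝ := Real.exp (-(δ / n) * supNorm (d := 4) w) / nrm (d := 4) w ^ 2 with hE₂
  set E₃ : ℝ := Real.exp (-(δ / n) * supNorm (d := 4) w) / nrm (d := 4) w ^ 3 with hE₃
  set c₂ : ℝ := Real.exp (δ * R) * ((R : ℝ) + 1) ^ 2 with hc₂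
  set c₃ : ℝ := Real.exp (δ * R) * ((R : ℝ) + 1) ^ 3 with hc₃
  have hnw := nrm_pos (d := 4) w
  have hE₂0 : 0 ≤ E₂ := by rw [hE₂]; positivity
  have hE₃0 : 0 ≤ E₃ := by rw [hE₃]; positivity
  have hEneg : ∀ p : ℕ, Real.exp (-(δ / n) * supNorm (d := 4) (-w)) / nrm (d := 4) (-w) ^ p
      = Real.exp (-(δ / n) * supNorm (d := 4) w) / nrm (d := 4) w ^ p := fun p => by rw [supNorm_neg, nrm_neg]
  -- window bookkeeping: `‖q − b‖ ≤ R`, `q − u = −w + (q − b)`, `u − q = w + (−(q − b))`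
  have hwin : ∀ q : Pt, DyadicShell.supNorm (q - b) ≤ R → supNorm (d := 4) (q - b) ≤ R := fun q hq => by rwa [supNorm_dyadic] at hq
  have hwin' : ∀ q : Pt, DyadicShell.supNorm (q - b) ≤ R → supNorm (d := 4) (-(q - b)) ≤ R := fun q hq => by rw [supNorm_neg]; exact hwin q hq
  have hqu : ∀ q : Pt, q - u = -w + (q - b) := fun q => by rw [hu]; abel
  have huq : ∀ q : Pt, u - q = w + -(q - b) := fun q => by rw [hu]; abel
  -- term 1's row end `Ga(u, ·)` in the window around `b`
  have hΦ₀ : ∀ (q : Pt) (κ l : Fin 4), DyadicShell.supNorm (q - b) ≤ R → |Ga n a u q κ l| ≤ A₀ * c₂ * E₂ := by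
    intro q κ l hq
    refine (hprof u q κ l).trans ?_
    rw [hqu q]
    refine (profile_window hA₀ hδ.le hn1 2 (hwin q hq)).trans (le_of_eq ?_)
    rw [hEneg 2, hc₂, hE₂]
  have hΦ₁ : ∀ (q : Pt) (κ l i : Fin 4), DyadicShell.supNorm (q - b) ≤ R → |Ga n a u (q + unitVec i) κ l - Ga n a u q κ l| ≤ A₁ * c₃ * E₃ := by
    intro q κ l i hq
    refine (hdR u q κ l i).trans ?_
    rw [hqu q]
    refine (profile_window hA₁ hδ.le hn1 3 (hwin q hq)).trans (le_of_eq ?_)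
    rw [hEneg 3, hc₃, hE₃]
  -- term 2's column end `Ga(·, u)` in the window around `b`
  have hΓ₀' : ∀ (q : Pt) (κ l : Fin 4), DyadicShell.supNorm (q - b) ≤ R → |Ga n a q u κ l| ≤ A₀ * c₂ * E₂ := by
    intro q κ l hq
    refine (hprof q u κ l).trans ?_
    rw [huq q]
    exact (profile_window hA₀ hδ.le hn1 2 (hwin' q hq)).trans (le_of_eq (by rw [hc₂, hE₂]))
  have hΓ₁' : ∀ (q : Pt) (κ l i : Fin 4), DyadicShell.supNorm (q - b) ≤ R → |Ga n a (q + unitVec i) u κ l - Ga n a q u κ l| ≤ A₁ * c₃ * E₃ := by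
    intro q κ l i hq
    refine (hdL q u κ l i).trans ?_
    rw [hqu q]
    refine (profile_window hA₁ hδ.le hn1 3 (hwin q hq)).trans (le_of_eq ?_)
    rw [hEneg 3, hc₃, hE₃]
  -- localisation data for the split of `dJetSw`
  have hP := decays_Pgt n (a := a) ha
  have hδP : 0 < deltaPP 4 a / (4 * (n : ℝ)) := by have := deltaPP_pos 4 ha; positivity
  obtain ⟨Cs, δs, hδs, hS⟩ := exists_biLoc_SbT
  have hLocS : Loc (SbT ν b) := ⟨b, b, Cs, δs, hδs, hS ν b⟩
  set c' : Pt → Fin 4 → ℝ := colGrad (Pgt n a) (u + (AffineAveraging.unitVec μ : Pt)) with hc'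
  set r' : Pt → Fin 4 → ℝ := rowGrad (Pgt n a) (u + (AffineAveraging.unitVec μ : Pt)) with hr'
  -- the word, split into the two rank-one terms
  have hword : biBubbleTable (Ga n a) (Ga n a) (projPiece n a) SbT μ ν (b + w) b =
      -(1 / 2 : ℝ) * (bubble (Ga n a) (outer c' (bondInd μ u)) (SbT ν b) - bubble (Ga n a) (outer (bondInd μ u) r') (SbT ν b)) := by
    rw [biBubbleTable_apply, ← hu, projPiece_apply, dJetSw_eq_outer_sub, ← bubble_eq_biBubble,
      bubble_outer_sub_left hA hLocS (locV_colGrad hP hδP _) (locV_bondInd μ u) (locV_bondInd μ u) (locV_rowGrad hP hδP _)]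
  -- summability of the two row ends
  have hsum1 : ∀ (s : Pt) (g : Fin 4), Summable fun x : Pt => ∑ a', bondInd μ u x a' * Ga n a x s a' g := by
    intro s g
    refine summable_of_ne_finset_zero (s := {u}) fun x hx => ?_
    rw [Finset.mem_singleton] at hx
    exact Finset.sum_eq_zero fun a' _ => by rw [bondInd_apply, if_neg (fun h => hx h.1), zero_mul]
  have hsum2 : ∀ (s : Pt) (g : Fin 4), Summable fun x : Pt => ∑ a', r' x a' * Ga n a x s a' g := by
    intro s g
    obtain ⟨C, δ', hδ', hGa⟩ := hA
    have hC : 0 ≤ C := hGa.nonneg g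
    have hr'b : ∀ (x : Pt) (a' : Fin 4), |r' x a'| ≤ cPPs 4 a / (n : ℝ) ^ 5 := by
      intro x a'
      set p : Pt := u + (AffineAveraging.unitVec μ : Pt) with hp
      rw [hr', show rowGrad (Pgt n a) p x a' = Pgt n a p (x + e a') () () - Pgt n a p x () () from rfl, Pgt_symm n ha p (x + e a'),
        Pgt_symm n ha p x]
      refine (abs_Pgt_diff_le_sup n ha x p a' () ()).trans (mul_le_of_le_one_right (by have := cPPs_nonneg 4 ha; positivity) ?_)
      rw [Real.exp_le_one_iff]; have : 0 ≤ deltaPP 4 a * dist (blk (n - 1) x) (blk (n - 1) p) := by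
        have := deltaPP_pos 4 ha; positivity
      linarith
    refine Summable.of_norm_bounded (g := fun x => ∑ _a' : Fin 4, cPPs 4 a / (n : ℝ) ^ 5 * (C * Real.exp (-δ' * l1 (x - s)))) ?_ fun x => ?_
    · exact summable_sum fun a' _ => ((summable_exp_shift' hδ' s).mul_left C).mul_left _
    · rw [Real.norm_eq_abs]
      refine (Finset.abs_sum_le_sum_abs _ _).trans (Finset.sum_le_sum fun a' _ => ?_)
      rw [abs_mul]
      exact mul_le_mul (hr'b x a') (hGa x s a' g) (abs_nonneg _) (by have := cPPs_nonneg 4 ha; positivity)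
  -- term 1: row end `Ga(u, ·)`, column end `Ga c′`
  have ht1 : |bubble (Ga n a) (outer c' (bondInd μ u)) (SbT ν b)| ≤ K * (A₁ * c₃ * E₃ * KC + A₀ * c₂ * E₂ * KC₁ + A₁ * c₃ * E₃ * KC₁) := by
    rw [bubble_eq_biBubble]
    refine hframe ν b (Ga n a) (Ga n a) c' (bondInd μ u) hsum1 (A₀ * c₂ * E₂) (A₁ * c₃ * E₃) KC KC₁ (by positivity) (by positivity) hKC hKC₁
      (fun q g hq => ?_) (fun q g i hq => ?_) (fun q f _ => hC0 _ q f) (fun q f i _ => hC1 _ q f i)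
    · rw [applyKT_bondInd]; exact hΦ₀ q μ g hq
    · rw [applyKT_bondInd]; exact hΦ₁ q μ g i hq
  -- term 2: row end `r′Ga`, column end `Ga(·, u)`
  have ht2 : |bubble (Ga n a) (outer (bondInd μ u) r') (SbT ν b)| ≤ K * (KC₁ * (A₀ * c₂ * E₂) + KC * (A₁ * c₃ * E₃) + KC₁ * (A₁ * c₃ * E₃)) := by
    rw [bubble_eq_biBubble]
    refine hframe ν b (Ga n a) (Ga n a) (bondInd μ u) r' hsum2 KC KC₁ (A₀ * c₂ * E₂) (A₁ * c₃ * E₃) hKC hKC₁ (by positivity) (by positivity)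
      (fun q g _ => hT0 _ q g) (fun q g i _ => hT1 _ q g i) (fun q f hq => ?_) (fun q f i hq => ?_)
    · rw [applyK_bondInd]; exact hΓ₀' q f μ hq
    · rw [applyK_bondInd]; exact hΓ₁' q f μ i hq
  -- assemble
  rw [hword, abs_mul, show |(-(1 / 2 : ℝ))| = 1 / 2 by norm_num]
  have htri : |bubble (Ga n a) (outer c' (bondInd μ u)) (SbT ν b) - bubble (Ga n a) (outer (bondInd μ u) r') (SbT ν b)|
      ≤ |bubble (Ga n a) (outer c' (bondInd μ u)) (SbT ν b)| + |bubble (Ga n a) (outer (bondInd μ u) r') (SbT ν b)| := by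
    rw [sub_eq_add_neg]; exact (abs_add_le _ _).trans (by rw [abs_neg])
  calc (1 / 2 : ℝ) * |bubble (Ga n a) (outer c' (bondInd μ u)) (SbT ν b) - bubble (Ga n a) (outer (bondInd μ u) r') (SbT ν b)|
      ≤ (1 / 2 : ℝ) * (K * (A₁ * c₃ * E₃ * KC + A₀ * c₂ * E₂ * KC₁ + A₁ * c₃ * E₃ * KC₁)
          + K * (KC₁ * (A₀ * c₂ * E₂) + KC * (A₁ * c₃ * E₃) + KC₁ * (A₁ * c₃ * E₃))) :=
        mul_le_mul_of_nonneg_left (htri.trans (add_le_add ht1 ht2)) (by norm_num)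
    _ = K * (A₁ * c₃ * E₃ * (KC + KC₁) + A₀ * c₂ * E₂ * KC₁) := by ring

end Word

/-! ## §2 The cell: frame and letters instantiated, n-powers cancelled -/

/-- [folklore] **«T₂-P»: THE `proj ⊗ SbT` PIECE OF T₂ IS n-UNIFORM**, modulo [B5, Prop. 1.2] ∧ [B5, (1.126)–(1.127)] BY NAME: one `C ≥ 0` with
`|cellSum n a (projPiece n a) SbT μ ν| ≤ C` for every `n ≥ 1` — hypothesis `hp` of `GluonNeedleGlueT12.h₂_of_pieces` (there for `n ≥ 2`, a fortiori). -/
theorem exists_projLoc_row_le (a : ℝ) (ha : 0 < a) (h12 : B5.Prop12Printed (fam nOf hn1 MOf a ha)) (h126 : B5.Kernel126_127Printed (kfam nOf MOf))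
    (μ ν : Fin 4) : ∃ C : ℝ, 0 ≤ C ∧ ∀ (n : ℕ) [NeZero n], |cellSum n a (projPiece n a) SbT μ ν| ≤ C := by
  obtain ⟨K, R, hK, hframe⟩ := exists_SbT_outer_bound_left
  obtain ⟨A₀, δa, hδa, hA₀, hprof⟩ := exists_abs_Ga_le_profile a ha h12 h126
  obtain ⟨A₁, δb, hδb, hA₁, hdR⟩ := exists_abs_Ga_diff_le_profile a ha h12 h126
  obtain ⟨A₂, δc, hδc, hA₂, hdL⟩ := exists_abs_Ga_diff_left_le_profile a ha h12 h126
  obtain ⟨kC, δ₁, _, hkC, hKC⟩ := exists_applyK_colGrad_le a ha h12 h126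
  obtain ⟨kT, δ₂, _, hkT, hKT⟩ := exists_applyKT_rowGrad_le a ha h12 h126
  obtain ⟨kC', δ₃, _, hkC', hKC'⟩ := exists_applyK_colGrad_diff_le a ha h12 h126
  obtain ⟨kT', δ₄, _, hkT', hKT'⟩ := exists_applyKT_rowGrad_diff_le a ha h12 h126
  -- common constants: rate δm := min of the three profile rates, A₁m := max A₁ A₂, kM := max kC kT, kM' := max kC' kT'
  set δm : ℝ := min δa (min δb δc) with hδm
  have hδm0 : 0 < δm := lt_min hδa (lt_min hδb hδc)
  have hδma : δm ≤ δa := min_le_left _ _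
  have hδmb : δm ≤ δb := (min_le_right _ _).trans (min_le_left _ _)
  have hδmc : δm ≤ δc := (min_le_right _ _).trans (min_le_right _ _)
  set A₁m : ℝ := max A₁ A₂ with hA₁m
  have hA₁m0 : 0 ≤ A₁m := hA₁.trans (le_max_left _ _)
  set kM : ℝ := max kC kT with hkM
  have hkM0 : 0 ≤ kM := hkC.trans (le_max_left _ _)
  set kM' : ℝ := max kC' kT' with hkM'
  have hkM'0 : 0 ≤ kM' := hkC'.trans (le_max_left _ _)
  set C : ℝ := K * (A₁m * (Real.exp (δm * R) * ((R : ℝ) + 1) ^ 3) * (kM + kM') * (1 + 432 * ((2 / δm) ^ 2 * (1 + 2 / δm)))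
      + A₀ * (Real.exp (δm * R) * ((R : ℝ) + 1) ^ 2) * kM' * (1 + 1296 * ((2 / δm) ^ 3 * (1 + 2 / δm)))) with hC
  refine ⟨C, by positivity, fun n _ => ?_⟩
  have hn : (0 : ℝ) < n := by exact_mod_cast Nat.pos_of_ne_zero (NeZero.ne n)
  have hA : Spr (Ga n a) := spr_Ga_of_prop12 (a := a) (ha := ha) h12 h126 n
  -- the letters at this n, weakened to the common constants
  have hexpm : ∀ {δ' : ℝ}, δm ≤ δ' → ∀ t : ℝ, 0 ≤ t → Real.exp (-(δ' / n) * t) ≤ Real.exp (-(δm / n) * t) := by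
    intro δ' hle t ht
    rw [Real.exp_le_exp]
    have : δm / n * t ≤ δ' / n * t := mul_le_mul_of_nonneg_right (div_le_div_of_nonneg_right hle hn.le) ht
    linarith
  have hprofn : ∀ (x y : Pt) (κ l : Fin 4), |Ga n a x y κ l| ≤ A₀ * Real.exp (-(δm / n) * supNorm (d := 4) (y - x)) / nrm (d := 4) (y - x) ^ 2 :=
    fun x y κ l => (hprof n x y κ l).trans (div_le_div_of_nonneg_right
      (mul_le_mul_of_nonneg_left (hexpm hδma _ (by positivity)) hA₀) (by have := nrm_pos (d := 4) (y - x); positivity))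
  have hdRn : ∀ (x y : Pt) (κ l ρ : Fin 4), |Ga n a x (y + unitVec ρ) κ l - Ga n a x y κ l|
      ≤ A₁m * Real.exp (-(δm / n) * supNorm (d := 4) (y - x)) / nrm (d := 4) (y - x) ^ 3 :=
    fun x y κ l ρ => (hdR n x y κ l ρ).trans (div_le_div_of_nonneg_right
      (mul_le_mul (le_max_left _ _) (hexpm hδmb _ (by positivity)) (Real.exp_pos _).le hA₁m0) (by have := nrm_pos (d := 4) (y - x); positivity))
  have hdLn : ∀ (x y : Pt) (κ l ρ : Fin 4), |Ga n a (x + unitVec ρ) y κ l - Ga n a x y κ l|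
      ≤ A₁m * Real.exp (-(δm / n) * supNorm (d := 4) (x - y)) / nrm (d := 4) (x - y) ^ 3 :=
    fun x y κ l ρ => (hdL n x y κ l ρ).trans (div_le_div_of_nonneg_right
      (mul_le_mul (le_max_right _ _) (hexpm hδmc _ (by positivity)) (Real.exp_pos _).le hA₁m0) (by have := nrm_pos (d := 4) (x - y); positivity))
  have hexp1 : ∀ {δ' : ℝ} (_ : 0 < δ') (t : ℝ), 0 ≤ t → Real.exp (-(δ' * t)) ≤ 1 := fun hδ' t ht => by
    rw [Real.exp_le_one_iff]; nlinarith
  have hC0n : ∀ (q x : Pt) (α : Fin 4), |applyK (Ga n a) (colGrad (Pgt n a) q) x α| ≤ kM / (n : ℝ) ^ 3 := fun q x α =>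
    (hKC n q x α).trans ((mul_le_of_le_one_right (by positivity) (hexp1 (by assumption) _ dist_nonneg)).trans
      (div_le_div_of_nonneg_right (le_max_left _ _) (by positivity)))
  have hT0n : ∀ (p z : Pt) (β : Fin 4), |applyKT (rowGrad (Pgt n a) p) (Ga n a) z β| ≤ kM / (n : ℝ) ^ 3 := fun p z β =>
    (hKT n p z β).trans ((mul_le_of_le_one_right (by positivity) (hexp1 (by assumption) _ dist_nonneg)).trans
      (div_le_div_of_nonneg_right (le_max_right _ _) (by positivity)))
  have hC1n : ∀ (q x : Pt) (α i : Fin 4), |applyK (Ga n a) (colGrad (Pgt n a) q) (x + unitVec i) α - applyK (Ga n a) (colGrad (Pgt n a) q) x α|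
      ≤ kM' / (n : ℝ) ^ 4 := fun q x α i =>
    (hKC' n q x α i).trans ((mul_le_of_le_one_right (by positivity) (hexp1 (by assumption) _ dist_nonneg)).trans
      (div_le_div_of_nonneg_right (le_max_left _ _) (by positivity)))
  have hT1n : ∀ (p z : Pt) (β i : Fin 4), |applyKT (rowGrad (Pgt n a) p) (Ga n a) (z + unitVec i) β - applyKT (rowGrad (Pgt n a) p) (Ga n a) z β|
      ≤ kM' / (n : ℝ) ^ 4 := fun p z β i =>
    (hKT' n p z β i).trans ((mul_le_of_le_one_right (by positivity) (hexp1 (by assumption) _ dist_nonneg)).trans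
      (div_le_div_of_nonneg_right (le_max_right _ _) (by positivity)))
  -- one base site: pointwise two-envelope bound, then the (1.22) sum, then the n-powers
  set c₂ : ℝ := Real.exp (δm * R) * ((R : ℝ) + 1) ^ 2 with hc₂
  set c₃ : ℝ := Real.exp (δm * R) * ((R : ℝ) + 1) ^ 3 with hc₃
  have hpt : ∀ b w : Pt, |biBubbleTable (Ga n a) (Ga n a) (projPiece n a) SbT μ ν (b + w) b|
      ≤ (K * (A₁m * c₃ * (kM / (n : ℝ) ^ 3 + kM' / (n : ℝ) ^ 4))) * (Real.exp (-(δm / n) * supNorm (d := 4) w) / nrm (d := 4) w ^ 3)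
        + (K * (A₀ * c₂ * (kM' / (n : ℝ) ^ 4))) * (Real.exp (-(δm / n) * supNorm (d := 4) w) / nrm (d := 4) w ^ 2) := fun b w =>
    (abs_projLoc_word_le n a ha hA hframe hA₀ hA₁m0 hδm0 (KC := kM / (n : ℝ) ^ 3) (KC₁ := kM' / (n : ℝ) ^ 4)
      (by positivity) (by positivity) hprofn hdRn hdLn hC0n hC1n hT0n hT1n μ ν b w).trans (le_of_eq (by rw [hc₂, hc₃]; ring))
  have hkM'le : kM' / (n : ℝ) ^ 4 ≤ kM' / (n : ℝ) ^ 3 :=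
    div_le_div_of_nonneg_left hkM'0 (by positivity) (pow_le_pow_right₀ (by exact_mod_cast NeZero.one_le) (by norm_num))
  have hsite : ∀ b : Pt, |fullSum (fun w : Pt => toReal w μ * toReal w ν *
      biBubbleTable (Ga n a) (Ga n a) (projPiece n a) SbT μ ν (b + w) b)| ≤ C := by
    intro b
    refine (abs_fullSum_le_of_envelope n hδm0 (by positivity) (by positivity) (hpt b) μ ν).trans ?_
    rw [hC]
    have e1 : K * (A₀ * c₂ * (kM' / (n : ℝ) ^ 4)) * ((1 + 1296 * ((2 / δm) ^ 3 * (1 + 2 / δm))) * (n : ℝ) ^ 4)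
        = K * (A₀ * (Real.exp (δm * R) * ((R : ℝ) + 1) ^ 2) * kM' * (1 + 1296 * ((2 / δm) ^ 3 * (1 + 2 / δm)))) := by
      rw [hc₂]; field_simp
    have e2 : K * (A₁m * c₃ * (kM / (n : ℝ) ^ 3 + kM' / (n : ℝ) ^ 4)) * ((1 + 432 * ((2 / δm) ^ 2 * (1 + 2 / δm))) * (n : ℝ) ^ 3)
        ≤ K * (A₁m * (Real.exp (δm * R) * ((R : ℝ) + 1) ^ 3) * (kM + kM') * (1 + 432 * ((2 / δm) ^ 2 * (1 + 2 / δm)))) := by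
      have h2 : kM / (n : ℝ) ^ 3 + kM' / (n : ℝ) ^ 4 ≤ (kM + kM') / (n : ℝ) ^ 3 := by rw [add_div]; exact add_le_add le_rfl hkM'le
      have h3 : K * (A₁m * c₃ * (kM / (n : ℝ) ^ 3 + kM' / (n : ℝ) ^ 4)) ≤ K * (A₁m * c₃ * ((kM + kM') / (n : ℝ) ^ 3)) :=
        mul_le_mul_of_nonneg_left (mul_le_mul_of_nonneg_left h2 (by positivity)) hK
      refine (mul_le_mul_of_nonneg_right h3 (by positivity)).trans (le_of_eq ?_)
      rw [hc₃]; field_simp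
    exact (add_le_add e2 (le_of_eq e1)).trans (le_of_eq (by ring))
  rw [cellSum_def]
  calc |∑ b ∈ (univ : Finset (Fin 4 → Fin n)).image resSite, ((n : ℝ) ^ 4)⁻¹ *
          fullSum (fun w : Pt => toReal w μ * toReal w ν * biBubbleTable (Ga n a) (Ga n a) (projPiece n a) SbT μ ν (b + w) b)|
      ≤ ∑ b ∈ (univ : Finset (Fin 4 → Fin n)).image resSite, ((n : ℝ) ^ 4)⁻¹ * C := by
        refine (Finset.abs_sum_le_sum_abs _ _).trans (Finset.sum_le_sum fun b _ => ?_)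
        rw [abs_mul, abs_of_nonneg (by positivity : (0 : ℝ) ≤ ((n : ℝ) ^ 4)⁻¹)]
        exact mul_le_mul_of_nonneg_left (hsite b) (by positivity)
    _ ≤ C := sum_resSite_avg_le (by positivity)

end

end Summit.QuantumFields.BalabanUV.Beta.D1BFx.GluonProjLocalRow
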